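import Mathlib.Tactic.Ring
import Mathlib.Tactic.LinearCombination
import Mathlib.Tactic.Linarith
import Mathlib.Data.Real.Basic
import HarnessLib

/-!
# Conjecture N has no content in format (3,1): every pure (3,1) configuration is degenerate

Prover 2, generation 10, hodge-weil ladder cell (note `b2b-hweil-pv2-g10/CROSS-MAX-G10.md` §1.3). Companion of
`WeilClassTestNullCone.lean` (generation 9) and `WeilClassTestChargeZeroLemma*.lean` (generation 8). Pure algebra; nothing here is a
rung or a cited fact; no statement of Markman's papers is used.

SETTING (note §1 of `b2b-hweil-pv2-g9/CONJECTURE-N.md`). A corank-one determinantal design of format `(e,f) = (3,1)` has three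
`E`-roots `(A_i, u_i)` and one `F`-root `(B, v)` (positions, real charges). CENTRING: `A₁+A₂+A₃ = B`, `u₁+u₂+u₃ = v` (the signed sums
`Σ_E − Σ_F` vanish). PURITY of `c₃(E − F)`: (P1) `Σ_E A²u = B²v`, (P2) `Σ_E Au² = Bv²`, (P4) `Σ_E u³ = v³`.
CLAIM. Then EITHER some `E`-root coincides with the `F`-root, `(A_i, u_i) = (B, v)` (the pair cancels in every signed sum; what is left is
the honest rank-2 format `(2,0)`, on which the charge-zero class-test quantity `G₀ = Q₂ + Q₄` vanishes identically), OR all charges vanish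
(`u ≡ 0 = v`, the constant-charge degeneracy `Q₂ = Q₄ = 0`). In both cases the ratio `R = −Q₄/Q₂` of Conjecture N is the undefined `0/0`:
format `(4,2)` is the first format in which Conjecture N says anything.
PROOF. With `v = u₁+u₂+u₃`, (P4) reads `3(u₁+u₂)(u₂+u₃)(u₁+u₃) = 0`. If `u₁+u₂ = 0` then `v = u₃` and (P2) reads
`(A₁+A₂)(u₁−u₃)(u₁+u₃) = 0`: `A₁+A₂ = 0` gives `(A₃,u₃) = (B,v)`; `u₃ = u₁` turns (P1) into `−2u₁(A₁+A₂)(A₂+A₃) = 0` and `u₃ = −u₁` turns it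
into `2u₁(A₁+A₂)(A₁+A₃) = 0`, each factor giving a coincidence or `u ≡ 0`. The other two cases are the same after relabelling. [folklore]
-/

namespace Literature.AlgebraicGeometry.HodgeTheory.WeilClassTestFormatThreeOne

/-- Core case `u₁ + u₂ = 0` of the (3,1) degeneracy (centring already substituted: `B = A₁+A₂+A₃`, `v = u₁+u₂+u₃`). [folklore] -/
theorem pure_format31_core (A₁ A₂ A₃ u₁ u₂ u₃ : ℝ) (h12 : u₁ + u₂ = 0)
    (hP1 : A₁ ^ 2 * u₁ + A₂ ^ 2 * u₂ + A₃ ^ 2 * u₃ = (A₁ + A₂ + A₃) ^ 2 * (u₁ + u₂ + u₃))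
    (hP2 : A₁ * u₁ ^ 2 + A₂ * u₂ ^ 2 + A₃ * u₃ ^ 2 = (A₁ + A₂ + A₃) * (u₁ + u₂ + u₃) ^ 2) :
    (A₁ = A₁ + A₂ + A₃ ∧ u₁ = u₁ + u₂ + u₃) ∨ (A₂ = A₁ + A₂ + A₃ ∧ u₂ = u₁ + u₂ + u₃) ∨
      (A₃ = A₁ + A₂ + A₃ ∧ u₃ = u₁ + u₂ + u₃) ∨ (u₁ = 0 ∧ u₂ = 0 ∧ u₃ = 0) := by
  have hu2 : u₂ = -u₁ := by linarith
  subst hu2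
  -- (P2) ⟹ (A₁+A₂)(u₁-u₃)(u₁+u₃) = 0
  have hP2' : (A₁ + A₂) * ((u₁ - u₃) * (u₁ + u₃)) = 0 := by linear_combination hP2
  rcases mul_eq_zero.mp hP2' with hA12 | hrest
  · -- A₁ + A₂ = 0 : root 3 cancels
    right; right; left
    exact ⟨by linarith, by ring⟩
  · rcases mul_eq_zero.mp hrest with h13 | h13'
    · -- u₃ = u₁ : (P1) ⟹ -2 u₁ (A₁+A₂)(A₂+A₃) = 0
      have hu3 : u₃ = u₁ := by linarith
      have hP1u := hP1
      rw [hu3] at hP1u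
      have hP1' : u₁ * ((A₁ + A₂) * (A₂ + A₃)) = 0 := by linear_combination (-1 / 2 : ℝ) * hP1u
      rcases mul_eq_zero.mp hP1' with hu0 | hAA
      · right; right; right
        exact ⟨hu0, by linarith, by linarith⟩
      · rcases mul_eq_zero.mp hAA with hA12 | hA23
        · right; right; left
          exact ⟨by linarith, by ring⟩
        · left
          exact ⟨by linarith, by linarith⟩
    · -- u₃ = -u₁ : (P1) ⟹ 2 u₁ (A₁+A₂)(A₁+A₃) = 0
      have hu3 : u₃ = -u₁ := by linarith
      have hP1u := hP1
      rw [hu3] at hP1u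
      have hP1' : u₁ * ((A₁ + A₂) * (A₁ + A₃)) = 0 := by linear_combination (1 / 2 : ℝ) * hP1u
      rcases mul_eq_zero.mp hP1' with hu0 | hAA
      · right; right; right
        exact ⟨hu0, by linarith, by linarith⟩
      · rcases mul_eq_zero.mp hAA with hA12 | hA13
        · right; right; left
          exact ⟨by linarith, by ring⟩
        · right; left
          exact ⟨by linarith, by linarith⟩

/-- FORMAT (3,1) IS DEGENERATE: a centred pure `(3,1)` configuration (positions `A₁,A₂,A₃ | B`, real charges `u₁,u₂,u₃ | v`,
centring `A₁+A₂+A₃ = B`, `u₁+u₂+u₃ = v`, purity (P1) `ΣA_i²u_i = B²v`, (P2) `ΣA_iu_i² = Bv²`, (P4) `Σu_i³ = v³`) has an `E`-root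
equal to the `F`-root, or all its charges vanish. Consequently the charge-zero class test of a pure (3,1) design is the degenerate
`0/0` case of Conjecture N (note CROSS-MAX-G10 §1.3). [folklore] -/
theorem pure_format31_degenerate (A₁ A₂ A₃ B u₁ u₂ u₃ v : ℝ)
    (hA : A₁ + A₂ + A₃ = B) (hu : u₁ + u₂ + u₃ = v)
    (hP1 : A₁ ^ 2 * u₁ + A₂ ^ 2 * u₂ + A₃ ^ 2 * u₃ = B ^ 2 * v)
    (hP2 : A₁ * u₁ ^ 2 + A₂ * u₂ ^ 2 + A₃ * u₃ ^ 2 = B * v ^ 2)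
    (hP4 : u₁ ^ 3 + u₂ ^ 3 + u₃ ^ 3 = v ^ 3) :
    (A₁ = B ∧ u₁ = v) ∨ (A₂ = B ∧ u₂ = v) ∨ (A₃ = B ∧ u₃ = v) ∨ (u₁ = 0 ∧ u₂ = 0 ∧ u₃ = 0 ∧ v = 0) := by
  subst hA; subst hu
  -- (P4) ⟹ (u₁+u₂)(u₂+u₃)(u₁+u₃) = 0
  have h4 : (u₁ + u₂) * ((u₂ + u₃) * (u₁ + u₃)) = 0 := by linear_combination (-1 / 3 : ℝ) * hP4
  have fin : ∀ {P Q R : Prop}, (P ∨ Q ∨ R ∨ (u₁ = 0 ∧ u₂ = 0 ∧ u₃ = 0)) →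
      (P ∨ Q ∨ R ∨ (u₁ = 0 ∧ u₂ = 0 ∧ u₃ = 0 ∧ u₁ + u₂ + u₃ = 0)) := by
    intro P Q R h
    rcases h with h | h | h | ⟨h1, h2, h3⟩
    · exact Or.inl h
    · exact Or.inr (Or.inl h)
    · exact Or.inr (Or.inr (Or.inl h))
    · exact Or.inr (Or.inr (Or.inr ⟨h1, h2, h3, by rw [h1, h2, h3]; ring⟩))
  rcases mul_eq_zero.mp h4 with h12 | hrest
  · exact fin (pure_format31_core A₁ A₂ A₃ u₁ u₂ u₃ h12 hP1 hP2)
  · rcases mul_eq_zero.mp hrest with h23 | h13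
    · -- relabel (1,2,3) -> (2,3,1)
      have hc := pure_format31_core A₂ A₃ A₁ u₂ u₃ u₁ h23
        (by linear_combination hP1) (by linear_combination hP2)
      rcases hc with ⟨hA2, hu2⟩ | ⟨hA3, hu3⟩ | ⟨hA1', hu1'⟩ | ⟨z2, z3, z1⟩
      · exact fin (Or.inr (Or.inl ⟨by linarith, by linarith⟩))
      · exact fin (Or.inr (Or.inr (Or.inl ⟨by linarith, by linarith⟩)))
      · exact fin (Or.inl ⟨by linarith, by linarith⟩)
      · exact fin (Or.inr (Or.inr (Or.inr ⟨z1, z2, z3⟩)))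
    · -- relabel (1,2,3) -> (1,3,2)
      have hc := pure_format31_core A₁ A₃ A₂ u₁ u₃ u₂ h13
        (by linear_combination hP1) (by linear_combination hP2)
      rcases hc with ⟨hA1', hu1'⟩ | ⟨hA3, hu3⟩ | ⟨hA2, hu2⟩ | ⟨z1, z3, z2⟩
      · exact fin (Or.inl ⟨by linarith, by linarith⟩)
      · exact fin (Or.inr (Or.inr (Or.inl ⟨by linarith, by linarith⟩)))
      · exact fin (Or.inr (Or.inl ⟨by linarith, by linarith⟩))
      · exact fin (Or.inr (Or.inr (Or.inr ⟨z1, z2, z3⟩)))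



/-! ### Appendix (same seat): in format (3,1) the charge-zero quantity lies in the purity ideal

Corner coordinates w.r.t. any vertex `(P*, M*)` of a pairwise-ample configuration (`E`-roots `k = 0,1,2` at light-cone position
`(P*, M*) + (p_k, q_k)`, the `F`-root `k = 3` at `(P*, M*) − (p₃, q₃)`, all `p_k, q_k ≥ 0`; dictionary `A_k = A* + ε_k(p_k+q_k)/2`,
`u_k = u* + ε_k(p_k−q_k)/2`, note `b2b-hweil-pv2-g9/CONJECTURE-N.md` §2). Below, `8·G₀` (`G₀ = Q₂ + Q₄`, the charge-zero class-test
quantity) and `8·d_j` (`d₁ = m₃₀ − m₂₁`, `d₂ = m₂₁ − m₁₂`, `d₃ = m₁₂ − m₀₃`, differences of the central cubic light-cone moments;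
purity ⟺ `d₁ = d₂ = d₃ = 0`, cf. `WeilClassTestNullCone.purity_iff_lightCone_cubic_moments_eq`) are written out with INTEGER coefficients
(generated exactly by `code/pv2-g10/polylib.py`). THE IDENTITY: `8·G₀ = (q₀+q₁+q₂+3q₃)·d₁ − 3[(q₀+q₁+q₂+3q₃) − (p₀+p₁+p₂+3p₃)]·d₂ − (p₀+p₁+p₂+3p₃)·d₃`
(the linear multipliers are unique). So `G₀ = 0` on every pure (3,1) configuration without case analysis; in format (4,2) the analogous
ideal membership fails with multipliers of degree ≤ 2 (note CROSS-MAX-G10 §3), which is where Conjecture N acquires content. -/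

set_option maxHeartbeats 1600000 in -- a 176-term quartic identity: `ring` needs more than the default budget
/-- FORMAT (3,1): `8·(8·G₀) = (q₀+q₁+q₂+3q₃)·(8·d₁) − 3((q₀+q₁+q₂+3q₃) − (p₀+p₁+p₂+3p₃))·(8·d₂) − (p₀+p₁+p₂+3p₃)·(8·d₃)`, an identity of
integer polynomials in the eight corner coordinates (so `G₀ ∈ (d₁,d₂,d₃)` with explicit linear multipliers). [folklore] -/
theorem format31_G0_mem_purity_ideal (p₀ q₀ p₁ q₁ p₂ q₂ p₃ q₃ : ℝ) :
    8 * (36 * p₃ * q₃ ^ 3 + -72 * p₃ ^ 2 * q₃ ^ 2 + 36 * p₃ ^ 3 * q₃ + 36 * q₂ * p₃ * q₃ ^ 2 + -48 * q₂ * p₃ ^ 2 * q₃ + 12 * q₂ * p₃ ^ 3 + 6 * q₂ ^ 2 * p₃ * q₃ + -4 * q₂ ^ 2 * p₃ ^ 2 + 12 * p₂ * q₃ ^ 3 + -48 * p₂ * p₃ * q₃ ^ 2 + 36 * p₂ * p₃ ^ 2 * q₃ + 6 * p₂ * q₂ * q₃ ^ 2 + -16 * p₂ * q₂ * p₃ *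 q₃ + 6 * p₂ * q₂ * p₃ ^ 2 + -4 * p₂ ^ 2 * q₃ ^ 2 + 6 * p₂ ^ 2 * p₃ * q₃ + 36 * q₁ * p₃ * q₃ ^ 2 + -48 * q₁ * p₃ ^ 2 * q₃ + 12 * q₁ * p₃ ^ 3 + 30 * q₁ * q₂ * p₃ * q₃ + -20 * q₁ * q₂ * p₃ ^ 2 + 3 * q₁ * q₂ ^ 2 * p₃ + 15 * q₁ * p₂ * q₃ ^ 2 + -40 * q₁ * p₂ * p₃ * q₃ + 15 * q₁ * p₂ * p₃ ^ 2 + 6 * q₁ * p₂ * q₂ * q₃ + -8 * q₁ * p₂ * q₂ * p₃ + -4 * q₁ * p₂ ^ 2 * q₃ + 3 * q₁ * p₂ ^ 2 * p₃ + 6 * q₁ ^ 2 * p₃ * q₃ + -4 * q₁ ^ 2 * p₃ ^ 2 + 3 * q₁ ^ 2 * q₂ * p₃ + 3 * q₁ ^ 2 * p₂ * q₃ + -4 * q₁ ^ 2 * p₂ * p₃ + 12 * p₁ * q₃ ^ 3 + -48 * p₁ * p₃ * q₃ ^ 2 + 36 * p₁ * p₃ ^ 2 * q₃ + 15 * p₁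 * q₂ * q₃ ^ 2 + -40 * p₁ * q₂ * p₃ * q₃ + 15 * p₁ * q₂ * p₃ ^ 2 + 3 * p₁ * q₂ ^ 2 * q₃ + -4 * p₁ * q₂ ^ 2 * p₃ + -20 * p₁ * p₂ * q₃ ^ 2 + 30 * p₁ * p₂ * p₃ * q₃ + -8 * p₁ * p₂ * q₂ * q₃ + 6 * p₁ * p₂ * q₂ * p₃ + 3 * p₁ * p₂ ^ 2 * q₃ + 6 * p₁ * q₁ * q₃ ^ 2 + -16 * p₁ * q₁ * p₃ * q₃ + 6 * p₁ * q₁ * p₃ ^ 2 + 6 * p₁ * q₁ * q₂ * q₃ + -8 * p₁ * q₁ * q₂ * p₃ + -8 * p₁ * q₁ * p₂ * q₃ + 6 * p₁ * q₁ * p₂ * p₃ + -4 * p₁ ^ 2 * q₃ ^ 2 + 6 * p₁ ^ 2 * p₃ * q₃ + -4 * p₁ ^ 2 * q₂ * q₃ + 3 * p₁ ^ 2 * q₂ * p₃ + 3 * p₁ ^ 2 * p₂ * q₃ + 36 * q₀ * p₃ * q₃ ^ 2 + -48 * q₀ * p₃ ^ 2 * q₃ + 12 * q₀ * p₃ ^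 3 + 30 * q₀ * q₂ * p₃ * q₃ + -20 * q₀ * q₂ * p₃ ^ 2 + 3 * q₀ * q₂ ^ 2 * p₃ + 15 * q₀ * p₂ * q₃ ^ 2 + -40 * q₀ * p₂ * p₃ * q₃ + 15 * q₀ * p₂ * p₃ ^ 2 + 6 * q₀ * p₂ * q₂ * q₃ + -8 * q₀ * p₂ * q₂ * p₃ + -4 * q₀ * p₂ ^ 2 * q₃ + 3 * q₀ * p₂ ^ 2 * p₃ + 30 * q₀ * q₁ * p₃ * q₃ + -20 * q₀ * q₁ * p₃ ^ 2 + 18 * q₀ * q₁ * q₂ * p₃ + 18 * q₀ * q₁ * p₂ * q₃ + -24 * q₀ * q₁ * p₂ * p₃ + 6 * q₀ * q₁ * p₂ * q₂ + -4 * q₀ * q₁ * p₂ ^ 2 + 3 * q₀ * q₁ ^ 2 * p₃ + 3 * q₀ * q₁ ^ 2 * p₂ + 15 * q₀ * p₁ * q₃ ^ 2 + -40 * q₀ * p₁ * p₃ * q₃ + 15 * q₀ * p₁ * p₃ ^ 2 + 18 * q₀ * p₁ * q₂ * q₃ + -24 * q₀ * p₁ * q₂ * p₃ + 3 * q₀ *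 p₁ * q₂ ^ 2 + -24 * q₀ * p₁ * p₂ * q₃ + 18 * q₀ * p₁ * p₂ * p₃ + -8 * q₀ * p₁ * p₂ * q₂ + 3 * q₀ * p₁ * p₂ ^ 2 + 6 * q₀ * p₁ * q₁ * q₃ + -8 * q₀ * p₁ * q₁ * p₃ + 6 * q₀ * p₁ * q₁ * q₂ + -8 * q₀ * p₁ * q₁ * p₂ + -4 * q₀ * p₁ ^ 2 * q₃ + 3 * q₀ * p₁ ^ 2 * p₃ + -4 * q₀ * p₁ ^ 2 * q₂ + 3 * q₀ * p₁ ^ 2 * p₂ + 6 * q₀ ^ 2 * p₃ * q₃ + -4 * q₀ ^ 2 * p₃ ^ 2 + 3 * q₀ ^ 2 * q₂ * p₃ + 3 * q₀ ^ 2 * p₂ * q₃ + -4 * q₀ ^ 2 * p₂ * p₃ + 3 * q₀ ^ 2 * q₁ * p₃ + 3 * q₀ ^ 2 * q₁ * p₂ + 3 * q₀ ^ 2 * p₁ * q₃ + -4 * q₀ ^ 2 * p₁ * p₃ + 3 * q₀ ^ 2 * p₁ * q₂ + -4 * q₀ ^ 2 * p₁ * p₂ + 12 * p₀ * q₃ ^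 3 + -48 * p₀ * p₃ * q₃ ^ 2 + 36 * p₀ * p₃ ^ 2 * q₃ + 15 * p₀ * q₂ * q₃ ^ 2 + -40 * p₀ * q₂ * p₃ * q₃ + 15 * p₀ * q₂ * p₃ ^ 2 + 3 * p₀ * q₂ ^ 2 * q₃ + -4 * p₀ * q₂ ^ 2 * p₃ + -20 * p₀ * p₂ * q₃ ^ 2 + 30 * p₀ * p₂ * p₃ * q₃ + -8 * p₀ * p₂ * q₂ * q₃ + 6 * p₀ * p₂ * q₂ * p₃ + 3 * p₀ * p₂ ^ 2 * q₃ + 15 * p₀ * q₁ * q₃ ^ 2 + -40 * p₀ * q₁ * p₃ * q₃ + 15 * p₀ * q₁ * p₃ ^ 2 + 18 * p₀ * q₁ * q₂ * q₃ + -24 * p₀ * q₁ * q₂ * p₃ + 3 * p₀ * q₁ * q₂ ^ 2 + -24 * p₀ * q₁ * p₂ * q₃ + 18 * p₀ * q₁ * p₂ * p₃ + -8 * p₀ * q₁ * p₂ * q₂ + 3 * p₀ * q₁ * p₂ ^ 2 + 3 * p₀ * q₁ ^ 2 * q₃ + -4 * p₀ * q₁ ^ 2 * p₃ + 3 * p₀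 * q₁ ^ 2 * q₂ + -4 * p₀ * q₁ ^ 2 * p₂ + -20 * p₀ * p₁ * q₃ ^ 2 + 30 * p₀ * p₁ * p₃ * q₃ + -24 * p₀ * p₁ * q₂ * q₃ + 18 * p₀ * p₁ * q₂ * p₃ + -4 * p₀ * p₁ * q₂ ^ 2 + 18 * p₀ * p₁ * p₂ * q₃ + 6 * p₀ * p₁ * p₂ * q₂ + -8 * p₀ * p₁ * q₁ * q₃ + 6 * p₀ * p₁ * q₁ * p₃ + -8 * p₀ * p₁ * q₁ * q₂ + 6 * p₀ * p₁ * q₁ * p₂ + 3 * p₀ * p₁ ^ 2 * q₃ + 3 * p₀ * p₁ ^ 2 * q₂ + 6 * p₀ * q₀ * q₃ ^ 2 + -16 * p₀ * q₀ * p₃ * q₃ + 6 * p₀ * q₀ * p₃ ^ 2 + 6 * p₀ * q₀ * q₂ * q₃ + -8 * p₀ * q₀ * q₂ * p₃ + -8 * p₀ * q₀ * p₂ * q₃ + 6 * p₀ * q₀ * p₂ * p₃ + 6 * p₀ * q₀ * q₁ * q₃ + -8 * p₀ * q₀ * q₁ * p₃ + 6 * p₀ * q₀ * q₁ * q₂ +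 -8 * p₀ * q₀ * q₁ * p₂ + -8 * p₀ * q₀ * p₁ * q₃ + 6 * p₀ * q₀ * p₁ * p₃ + -8 * p₀ * q₀ * p₁ * q₂ + 6 * p₀ * q₀ * p₁ * p₂ + -4 * p₀ ^ 2 * q₃ ^ 2 + 6 * p₀ ^ 2 * p₃ * q₃ + -4 * p₀ ^ 2 * q₂ * q₃ + 3 * p₀ ^ 2 * q₂ * p₃ + 3 * p₀ ^ 2 * p₂ * q₃ + -4 * p₀ ^ 2 * q₁ * q₃ + 3 * p₀ ^ 2 * q₁ * p₃ + -4 * p₀ ^ 2 * q₁ * q₂ + 3 * p₀ ^ 2 * q₁ * p₂ + 3 * p₀ ^ 2 * p₁ * q₃ + 3 * p₀ ^ 2 * p₁ * q₂)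
      = (q₀ + q₁ + q₂ + 3 * q₃) * (-24 * p₃ ^ 2 * q₃ + 24 * p₃ ^ 3 + -8 * q₂ * p₃ ^ 2 + -16 * p₂ * p₃ * q₃ + 24 * p₂ * p₃ ^ 2 + -8 * q₁ * p₃ ^ 2 + -8 * q₁ * p₂ * p₃ + -16 * p₁ * p₃ * q₃ + 24 * p₁ * p₃ ^ 2 + -8 * p₁ * q₂ * p₃ + -8 * p₁ * p₂ * q₃ + 24 * p₁ * p₂ * p₃ + -8 * q₀ * p₃ ^ 2 + -8 * q₀ * p₂ * p₃ + -8 * q₀ * p₁ * p₃ + -8 * q₀ * p₁ * p₂ + -16 * p₀ * p₃ * q₃ + 24 * p₀ * p₃ ^ 2 + -8 * p₀ * q₂ * p₃ + -8 * p₀ * p₂ * q₃ + 24 * p₀ * p₂ * p₃ + -8 * p₀ * q₁ * p₃ + -8 * p₀ * q₁ * p₂ + -8 * p₀ * p₁ * q₃ + 24 * p₀ * p₁ * p₃ + -8 * p₀ * p₁ * q₂ + 24 * p₀ * p₁ * p₂)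
        + (-3) * ((q₀ + q₁ + q₂ + 3 * q₃) - (p₀ + p₁ + p₂ + 3 * p₃)) * (-24 * p₃ * q₃ ^ 2 + 24 * p₃ ^ 2 * q₃ + -16 * q₂ * p₃ * q₃ + 8 * q₂ * p₃ ^ 2 + -8 * p₂ * q₃ ^ 2 + 16 * p₂ * p₃ * q₃ + -16 * q₁ * p₃ * q₃ + 8 * q₁ * p₃ ^ 2 + -8 * q₁ * q₂ * p₃ + -8 * q₁ * p₂ * q₃ + 8 * q₁ * p₂ * p₃ + -8 * p₁ * q₃ ^ 2 + 16 * p₁ * p₃ * q₃ + -8 * p₁ * q₂ * q₃ + 8 * p₁ * q₂ * p₃ + 8 * p₁ * p₂ * q₃ + -16 * q₀ * p₃ * q₃ + 8 * q₀ * p₃ ^ 2 + -8 * q₀ * q₂ * p₃ + -8 * q₀ * p₂ * q₃ + 8 * q₀ * p₂ * p₃ + -8 * q₀ * q₁ * p₃ + -8 * q₀ * q₁ * p₂ + -8 * q₀ * p₁ * q₃ + 8 * q₀ * p₁ * p₃ + -8 * q₀ * p₁ * q₂ + 8 * q₀ * p₁ * p₂ + -8 * p₀ * q₃ ^ 2 +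 16 * p₀ * p₃ * q₃ + -8 * p₀ * q₂ * q₃ + 8 * p₀ * q₂ * p₃ + 8 * p₀ * p₂ * q₃ + -8 * p₀ * q₁ * q₃ + 8 * p₀ * q₁ * p₃ + -8 * p₀ * q₁ * q₂ + 8 * p₀ * q₁ * p₂ + 8 * p₀ * p₁ * q₃ + 8 * p₀ * p₁ * q₂)
        + (-1) * (p₀ + p₁ + p₂ + 3 * p₃) * (-24 * q₃ ^ 3 + 24 * p₃ * q₃ ^ 2 + -24 * q₂ * q₃ ^ 2 + 16 * q₂ * p₃ * q₃ + 8 * p₂ * q₃ ^ 2 + -24 * q₁ * q₃ ^ 2 + 16 * q₁ * p₃ * q₃ + -24 * q₁ * q₂ * q₃ + 8 * q₁ * q₂ * p₃ + 8 * q₁ * p₂ * q₃ + 8 * p₁ * q₃ ^ 2 + 8 * p₁ * q₂ * q₃ + -24 * q₀ * q₃ ^ 2 + 16 * q₀ * p₃ * q₃ + -24 * q₀ * q₂ * q₃ + 8 * q₀ * q₂ * p₃ + 8 * q₀ * p₂ * q₃ + -24 * q₀ * q₁ * q₃ + 8 * q₀ * q₁ * p₃ + -24 * q₀ * q₁ *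 q₂ + 8 * q₀ * q₁ * p₂ + 8 * q₀ * p₁ * q₃ + 8 * q₀ * p₁ * q₂ + 8 * p₀ * q₃ ^ 2 + 8 * p₀ * q₂ * q₃ + 8 * p₀ * q₁ * q₃ + 8 * p₀ * q₁ * q₂) := by
  ring

set_option maxHeartbeats 1600000 in -- three 30-term cubic hypotheses
/-- Corollary: on a pure (3,1) configuration (`d₁ = d₂ = d₃ = 0` in corner coordinates) the charge-zero quantity `8·G₀` vanishes. [folklore] -/
theorem format31_G0_eq_zero_of_pure (p₀ q₀ p₁ q₁ p₂ q₂ p₃ q₃ : ℝ)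
    (h1 : -24 * p₃ ^ 2 * q₃ + 24 * p₃ ^ 3 + -8 * q₂ * p₃ ^ 2 + -16 * p₂ * p₃ * q₃ + 24 * p₂ * p₃ ^ 2 + -8 * q₁ * p₃ ^ 2 + -8 * q₁ * p₂ * p₃ + -16 * p₁ * p₃ * q₃ + 24 * p₁ * p₃ ^ 2 + -8 * p₁ * q₂ * p₃ + -8 * p₁ * p₂ * q₃ + 24 * p₁ * p₂ * p₃ + -8 * q₀ * p₃ ^ 2 + -8 * q₀ * p₂ * p₃ + -8 * q₀ * p₁ * p₃ + -8 * q₀ * p₁ * p₂ + -16 * p₀ * p₃ * q₃ + 24 * p₀ * p₃ ^ 2 + -8 * p₀ * q₂ * p₃ + -8 * p₀ * p₂ * q₃ + 24 * p₀ * p₂ * p₃ + -8 * p₀ * q₁ * p₃ + -8 * p₀ * q₁ * p₂ + -8 * p₀ * p₁ * q₃ + 24 * p₀ * p₁ * p₃ + -8 * p₀ * p₁ * q₂ + 24 * p₀ * p₁ * p₂ = 0)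
    (h2 : -24 * p₃ * q₃ ^ 2 + 24 * p₃ ^ 2 * q₃ + -16 * q₂ * p₃ * q₃ + 8 * q₂ * p₃ ^ 2 + -8 * p₂ * q₃ ^ 2 + 16 * p₂ * p₃ * q₃ + -16 * q₁ * p₃ * q₃ + 8 * q₁ * p₃ ^ 2 + -8 * q₁ * q₂ * p₃ + -8 * q₁ * p₂ * q₃ + 8 * q₁ * p₂ * p₃ + -8 * p₁ * q₃ ^ 2 + 16 * p₁ * p₃ * q₃ + -8 * p₁ * q₂ * q₃ + 8 * p₁ * q₂ * p₃ + 8 * p₁ * p₂ * q₃ + -16 * q₀ * p₃ * q₃ + 8 * q₀ * p₃ ^ 2 + -8 * q₀ * q₂ * p₃ + -8 * q₀ * p₂ * q₃ + 8 * q₀ * p₂ * p₃ + -8 * q₀ * q₁ * p₃ + -8 * q₀ * q₁ * p₂ + -8 * q₀ * p₁ * q₃ + 8 * q₀ * p₁ * p₃ + -8 * q₀ * p₁ * q₂ + 8 * q₀ * p₁ * p₂ + -8 * p₀ * q₃ ^ 2 + 16 * p₀ * p₃ * q₃ + -8 * p₀ * q₂ * q₃ + 8 * p₀ * q₂ * p₃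 + 8 * p₀ * p₂ * q₃ + -8 * p₀ * q₁ * q₃ + 8 * p₀ * q₁ * p₃ + -8 * p₀ * q₁ * q₂ + 8 * p₀ * q₁ * p₂ + 8 * p₀ * p₁ * q₃ + 8 * p₀ * p₁ * q₂ = 0)
    (h3 : -24 * q₃ ^ 3 + 24 * p₃ * q₃ ^ 2 + -24 * q₂ * q₃ ^ 2 + 16 * q₂ * p₃ * q₃ + 8 * p₂ * q₃ ^ 2 + -24 * q₁ * q₃ ^ 2 + 16 * q₁ * p₃ * q₃ + -24 * q₁ * q₂ * q₃ + 8 * q₁ * q₂ * p₃ + 8 * q₁ * p₂ * q₃ + 8 * p₁ * q₃ ^ 2 + 8 * p₁ * q₂ * q₃ + -24 * q₀ * q₃ ^ 2 + 16 * q₀ * p₃ * q₃ + -24 * q₀ * q₂ * q₃ + 8 * q₀ * q₂ * p₃ + 8 * q₀ * p₂ * q₃ + -24 * q₀ * q₁ * q₃ + 8 * q₀ * q₁ * p₃ + -24 * q₀ * q₁ * q₂ + 8 * q₀ * q₁ * p₂ + 8 * q₀ * p₁ * q₃ + 8 * q₀ * p₁ * q₂ + 8 * p₀ * q₃ ^ 2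 + 8 * p₀ * q₂ * q₃ + 8 * p₀ * q₁ * q₃ + 8 * p₀ * q₁ * q₂ = 0) :
    36 * p₃ * q₃ ^ 3 + -72 * p₃ ^ 2 * q₃ ^ 2 + 36 * p₃ ^ 3 * q₃ + 36 * q₂ * p₃ * q₃ ^ 2 + -48 * q₂ * p₃ ^ 2 * q₃ + 12 * q₂ * p₃ ^ 3 + 6 * q₂ ^ 2 * p₃ * q₃ + -4 * q₂ ^ 2 * p₃ ^ 2 + 12 * p₂ * q₃ ^ 3 + -48 * p₂ * p₃ * q₃ ^ 2 + 36 * p₂ * p₃ ^ 2 * q₃ + 6 * p₂ * q₂ * q₃ ^ 2 + -16 * p₂ * q₂ * p₃ * q₃ + 6 * p₂ * q₂ * p₃ ^ 2 + -4 * p₂ ^ 2 * q₃ ^ 2 + 6 * p₂ ^ 2 * p₃ * q₃ + 36 * q₁ * p₃ * q₃ ^ 2 + -48 * q₁ * p₃ ^ 2 * q₃ + 12 * q₁ * p₃ ^ 3 + 30 * q₁ * q₂ * p₃ * q₃ + -20 * q₁ * q₂ * p₃ ^ 2 + 3 * q₁ * q₂ ^ 2 * p₃ + 15 * q₁ * p₂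 * q₃ ^ 2 + -40 * q₁ * p₂ * p₃ * q₃ + 15 * q₁ * p₂ * p₃ ^ 2 + 6 * q₁ * p₂ * q₂ * q₃ + -8 * q₁ * p₂ * q₂ * p₃ + -4 * q₁ * p₂ ^ 2 * q₃ + 3 * q₁ * p₂ ^ 2 * p₃ + 6 * q₁ ^ 2 * p₃ * q₃ + -4 * q₁ ^ 2 * p₃ ^ 2 + 3 * q₁ ^ 2 * q₂ * p₃ + 3 * q₁ ^ 2 * p₂ * q₃ + -4 * q₁ ^ 2 * p₂ * p₃ + 12 * p₁ * q₃ ^ 3 + -48 * p₁ * p₃ * q₃ ^ 2 + 36 * p₁ * p₃ ^ 2 * q₃ + 15 * p₁ * q₂ * q₃ ^ 2 + -40 * p₁ * q₂ * p₃ * q₃ + 15 * p₁ * q₂ * p₃ ^ 2 + 3 * p₁ * q₂ ^ 2 * q₃ + -4 * p₁ * q₂ ^ 2 * p₃ + -20 * p₁ * p₂ * q₃ ^ 2 + 30 * p₁ * p₂ * p₃ * q₃ + -8 * p₁ * p₂ * q₂ * q₃ + 6 * p₁ * p₂ * q₂ * p₃ + 3 * p₁ * p₂ ^ 2 * q₃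 + 6 * p₁ * q₁ * q₃ ^ 2 + -16 * p₁ * q₁ * p₃ * q₃ + 6 * p₁ * q₁ * p₃ ^ 2 + 6 * p₁ * q₁ * q₂ * q₃ + -8 * p₁ * q₁ * q₂ * p₃ + -8 * p₁ * q₁ * p₂ * q₃ + 6 * p₁ * q₁ * p₂ * p₃ + -4 * p₁ ^ 2 * q₃ ^ 2 + 6 * p₁ ^ 2 * p₃ * q₃ + -4 * p₁ ^ 2 * q₂ * q₃ + 3 * p₁ ^ 2 * q₂ * p₃ + 3 * p₁ ^ 2 * p₂ * q₃ + 36 * q₀ * p₃ * q₃ ^ 2 + -48 * q₀ * p₃ ^ 2 * q₃ + 12 * q₀ * p₃ ^ 3 + 30 * q₀ * q₂ * p₃ * q₃ + -20 * q₀ * q₂ * p₃ ^ 2 + 3 * q₀ * q₂ ^ 2 * p₃ + 15 * q₀ * p₂ * q₃ ^ 2 + -40 * q₀ * p₂ * p₃ * q₃ + 15 * q₀ * p₂ * p₃ ^ 2 + 6 * q₀ * p₂ * q₂ * q₃ + -8 * q₀ * p₂ * q₂ * p₃ + -4 * q₀ * p₂ ^ 2 * q₃ + 3 * q₀ * p₂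 ^ 2 * p₃ + 30 * q₀ * q₁ * p₃ * q₃ + -20 * q₀ * q₁ * p₃ ^ 2 + 18 * q₀ * q₁ * q₂ * p₃ + 18 * q₀ * q₁ * p₂ * q₃ + -24 * q₀ * q₁ * p₂ * p₃ + 6 * q₀ * q₁ * p₂ * q₂ + -4 * q₀ * q₁ * p₂ ^ 2 + 3 * q₀ * q₁ ^ 2 * p₃ + 3 * q₀ * q₁ ^ 2 * p₂ + 15 * q₀ * p₁ * q₃ ^ 2 + -40 * q₀ * p₁ * p₃ * q₃ + 15 * q₀ * p₁ * p₃ ^ 2 + 18 * q₀ * p₁ * q₂ * q₃ + -24 * q₀ * p₁ * q₂ * p₃ + 3 * q₀ * p₁ * q₂ ^ 2 + -24 * q₀ * p₁ * p₂ * q₃ + 18 * q₀ * p₁ * p₂ * p₃ + -8 * q₀ * p₁ * p₂ * q₂ + 3 * q₀ * p₁ * p₂ ^ 2 + 6 * q₀ * p₁ * q₁ * q₃ + -8 * q₀ * p₁ * q₁ * p₃ + 6 * q₀ * p₁ * q₁ * q₂ + -8 * q₀ * p₁ * q₁ * p₂ + -4 * q₀ * p₁ ^ 2 * q₃ + 3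 * q₀ * p₁ ^ 2 * p₃ + -4 * q₀ * p₁ ^ 2 * q₂ + 3 * q₀ * p₁ ^ 2 * p₂ + 6 * q₀ ^ 2 * p₃ * q₃ + -4 * q₀ ^ 2 * p₃ ^ 2 + 3 * q₀ ^ 2 * q₂ * p₃ + 3 * q₀ ^ 2 * p₂ * q₃ + -4 * q₀ ^ 2 * p₂ * p₃ + 3 * q₀ ^ 2 * q₁ * p₃ + 3 * q₀ ^ 2 * q₁ * p₂ + 3 * q₀ ^ 2 * p₁ * q₃ + -4 * q₀ ^ 2 * p₁ * p₃ + 3 * q₀ ^ 2 * p₁ * q₂ + -4 * q₀ ^ 2 * p₁ * p₂ + 12 * p₀ * q₃ ^ 3 + -48 * p₀ * p₃ * q₃ ^ 2 + 36 * p₀ * p₃ ^ 2 * q₃ + 15 * p₀ * q₂ * q₃ ^ 2 + -40 * p₀ * q₂ * p₃ * q₃ + 15 * p₀ * q₂ * p₃ ^ 2 + 3 * p₀ * q₂ ^ 2 * q₃ + -4 * p₀ * q₂ ^ 2 * p₃ + -20 * p₀ * p₂ * q₃ ^ 2 + 30 * p₀ * p₂ * p₃ * q₃ + -8 * p₀ *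 p₂ * q₂ * q₃ + 6 * p₀ * p₂ * q₂ * p₃ + 3 * p₀ * p₂ ^ 2 * q₃ + 15 * p₀ * q₁ * q₃ ^ 2 + -40 * p₀ * q₁ * p₃ * q₃ + 15 * p₀ * q₁ * p₃ ^ 2 + 18 * p₀ * q₁ * q₂ * q₃ + -24 * p₀ * q₁ * q₂ * p₃ + 3 * p₀ * q₁ * q₂ ^ 2 + -24 * p₀ * q₁ * p₂ * q₃ + 18 * p₀ * q₁ * p₂ * p₃ + -8 * p₀ * q₁ * p₂ * q₂ + 3 * p₀ * q₁ * p₂ ^ 2 + 3 * p₀ * q₁ ^ 2 * q₃ + -4 * p₀ * q₁ ^ 2 * p₃ + 3 * p₀ * q₁ ^ 2 * q₂ + -4 * p₀ * q₁ ^ 2 * p₂ + -20 * p₀ * p₁ * q₃ ^ 2 + 30 * p₀ * p₁ * p₃ * q₃ + -24 * p₀ * p₁ * q₂ * q₃ + 18 * p₀ * p₁ * q₂ * p₃ + -4 * p₀ * p₁ * q₂ ^ 2 + 18 * p₀ * p₁ * p₂ * q₃ + 6 * p₀ * p₁ * p₂ * q₂ + -8 * p₀ * p₁ * q₁ * q₃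 + 6 * p₀ * p₁ * q₁ * p₃ + -8 * p₀ * p₁ * q₁ * q₂ + 6 * p₀ * p₁ * q₁ * p₂ + 3 * p₀ * p₁ ^ 2 * q₃ + 3 * p₀ * p₁ ^ 2 * q₂ + 6 * p₀ * q₀ * q₃ ^ 2 + -16 * p₀ * q₀ * p₃ * q₃ + 6 * p₀ * q₀ * p₃ ^ 2 + 6 * p₀ * q₀ * q₂ * q₃ + -8 * p₀ * q₀ * q₂ * p₃ + -8 * p₀ * q₀ * p₂ * q₃ + 6 * p₀ * q₀ * p₂ * p₃ + 6 * p₀ * q₀ * q₁ * q₃ + -8 * p₀ * q₀ * q₁ * p₃ + 6 * p₀ * q₀ * q₁ * q₂ + -8 * p₀ * q₀ * q₁ * p₂ + -8 * p₀ * q₀ * p₁ * q₃ + 6 * p₀ * q₀ * p₁ * p₃ + -8 * p₀ * q₀ * p₁ * q₂ + 6 * p₀ * q₀ * p₁ * p₂ + -4 * p₀ ^ 2 * q₃ ^ 2 + 6 * p₀ ^ 2 * p₃ * q₃ + -4 * p₀ ^ 2 * q₂ * q₃ + 3 * p₀ ^ 2 * q₂ * p₃ + 3 * p₀ ^ 2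 * p₂ * q₃ + -4 * p₀ ^ 2 * q₁ * q₃ + 3 * p₀ ^ 2 * q₁ * p₃ + -4 * p₀ ^ 2 * q₁ * q₂ + 3 * p₀ ^ 2 * q₁ * p₂ + 3 * p₀ ^ 2 * p₁ * q₃ + 3 * p₀ ^ 2 * p₁ * q₂ = 0 := by
  have key := format31_G0_mem_purity_ideal p₀ q₀ p₁ q₁ p₂ q₂ p₃ q₃
  rw [h1, h2, h3] at key
  linarith

end Literature.AlgebraicGeometry.HodgeTheory.WeilClassTestFormatThreeOne
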